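import Summits.FinalStateConjecture.FinalStateConjecture.Theorems.EIHFluxBalanceModulatedKerrHandoffOneHoleLeibniz
import Summits.FinalStateConjecture.FinalStateConjecture.Theorems.EIHFluxBalanceInertialRecessionAnsatzDecay
import Summits.FinalStateConjecture.FinalStateConjecture.Theorems.EIHFluxBalanceInertialRecessionAnsatzSmooth
import Mathlib.Analysis.Calculus.Deriv.Mul

/-!
# Route EIHFluxBalance — `ModulatedKerrHandoff`, stub `stub_oneHoleMatching`: the moduli paths

Helper file for the crux `stmt-FinalStateConjecture-10167`
(`Summit.FinalStateConjecture.FinalStateConjecture.Theses.EIHFluxBalance.ModulatedKerrHandoff`),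
line `photon-rocket-modulation`, stub `stub_oneHoleMatching` (one-hole profile matching).

The moduli of one hole are the boost path `Λ : ℝ → O(1,3)`, the world-line `ξ : ℝ → E3` and the
mass path; the kernel of `…OneHoleKernel` is fed the INVERSE boost `θ(u) = Λ(u)⁻¹`, the centre event
`c(u) = (u, ξ(u))` and the rest-frame offset of the centre `b(u) = S Λ(u)⁻¹ c(u)`. This file turns the
hypotheses of the stub (bounds on `Λ⁽ᵏ⁾`, `ξ⁽ᵏ⁾`, the Lorentz factor `(Λe₀)⁰ ≤ γ`, and the ALIGNMENT
`Λ(u)e₀ = γ(u) (1, ξ′(u))`) into what the matching consumes: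

* `theta_eq_sum` — **`Λ⁻¹` is linear in `Λ`** on the Lorentz group: `Λ⁻¹w = Σ_μ η_μμ η(w, Λe_μ) e_μ`
  (O'Neill 1983, Ch. 9, p. 234: `Λ⁻¹ = ηΛᵀη`), so every derivative bound — global or tame — of
  `u ↦ Λ(u)` transfers to `u ↦ Λ(u)⁻¹` with a universal constant (`norm_iteratedDeriv_theta_le`);
* `norm_theta_le` — `‖Λ(u)⁻¹‖ ≤ 1 + 3γ`;
* `theta_apply_velocity` — **alignment in the rest frame**: `Λ(u)⁻¹ (1, ξ′(u)) = γ(u)⁻¹ e₀`, whose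
  spatial part vanishes: the centre's velocity drops out of the rest-frame position;
* `deriv_restOffset` — hence `b′(u) = S (Λ⁻¹)′(u) c(u)`: the rest-frame offset of the centre moves
  only through the (tame) rotation of the frame, and `norm_iteratedDeriv_restOffset_le` bounds its
  higher derivatives by Leibniz.
-/

noncomputable section

-- `Summit.<S>.<S>.…` (single-problem summit, D-0017) trips core's duplicate-namespace linter.
set_option linter.dupNamespace false

open Set Filter Function Literature.Geometry.Lorentzian
open scoped Topology ContDiff

namespace Summit.FinalStateConjecture.FinalStateConjecture.Theorems

namespace OneHole

/-! ### The inverse boost is linear in the boost -/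

/-- Coordinate expansion with the Minkowski form: `z = Σ_μ η_μμ η(z, e_μ) e_μ` (`η_00 = −1`,
`η_ii = 1`; O'Neill 1983, Ch. 3, p. 55). [folklore] -/
theorem sum_sign_smul_bilin_basisVector (z : E4) :
    ∑ μ : Fin 4, (if μ = 0 then (-1 : ℝ) else 1) •
      (Minkowski.bilin z (E4.basisVector μ) • E4.basisVector μ) = z := by
  ext i
  fin_cases i <;> simp [Fin.sum_univ_four, Minkowski.bilin_apply, Fin.sum_univ_three, E4.basisVector]

/-- **`Λ⁻¹` from `Λ` by `η`-duality**: `Λ⁻¹ w = Σ_μ η_μμ η(w, Λ e_μ) e_μ` for `Λ ∈ O(1,3)` (apply the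
coordinate expansion to `Λ⁻¹w` and use `η(Λ⁻¹w, e_μ) = η(w, Λe_μ)`; O'Neill 1983, Ch. 9, p. 234,
`Λ⁻¹ = ηΛᵀη`). [folklore] -/
theorem lorentz_symm_apply_eq_sum (Λ : lorentzGroup) (w : E4) :
    (Λ : E4 ≃L[ℝ] E4).symm w = ∑ μ : Fin 4, (if μ = 0 then (-1 : ℝ) else 1) •
      (Minkowski.bilin w ((Λ : E4 ≃L[ℝ] E4) (E4.basisVector μ)) • E4.basisVector μ) := by
  conv_lhs => rw [← sum_sign_smul_bilin_basisVector ((Λ : E4 ≃L[ℝ] E4).symm w)]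
  refine Finset.sum_congr rfl fun μ _ ↦ ?_
  have h := Λ.2 ((Λ : E4 ≃L[ℝ] E4).symm w) (E4.basisVector μ)
  rw [ContinuousLinearEquiv.apply_symm_apply] at h
  rw [h]

/-- The same as an identity of operators: `Λ⁻¹ = Σ_μ η_μμ (η(·, Λe_μ)) ⊗ e_μ`, each summand obtained
from `Λ` by a FIXED continuous linear operation (evaluation at `e_μ`, `η`-duality, tensoring with
`e_μ`). [folklore] -/
theorem lorentz_symm_eq_sum (Λ : lorentzGroup) :
    (((Λ : E4 ≃L[ℝ] E4).symm : E4 ≃L[ℝ] E4) : E4 →L[ℝ] E4) =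
      ∑ μ : Fin 4, (if μ = 0 then (-1 : ℝ) else 1) •
        ((((ContinuousLinearMap.smulRightL ℝ E4 E4).flip (E4.basisVector μ)).comp
          (Minkowski.bilin : E4 →L[ℝ] E4 →L[ℝ] ℝ).flip)
          ((ContinuousLinearMap.apply ℝ E4 (E4.basisVector μ)) ((Λ : E4 ≃L[ℝ] E4) : E4 →L[ℝ] E4))) := by
  refine ContinuousLinearMap.ext fun w ↦ ?_
  rw [ContinuousLinearEquiv.coe_coe, lorentz_symm_apply_eq_sum, _root_.sum_apply]
  refine Finset.sum_congr rfl fun μ _ ↦ ?_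
  rw [FunLike.coe_smul, Pi.smul_apply]
  congr 1

/-- **Derivative bounds transfer from `Λ` to `Λ⁻¹` linearly.** There is a universal constant `C_θ ≥ 0`
such that for every smooth boost path and every `u`, `k`:
`‖(Λ⁻¹)⁽ᵏ⁾(u)‖ ≤ C_θ ‖Λ⁽ᵏ⁾(u)‖` (`Λ⁻¹` is a fixed linear function of `Λ` on `O(1,3)`). [folklore] -/
theorem exists_norm_iteratedDeriv_theta_le :
    ∃ Cθ : ℝ, 0 ≤ Cθ ∧ ∀ (Λ : ℝ → lorentzGroup),
      ContDiff ℝ ∞ (fun t ↦ ((Λ t : E4 ≃L[ℝ] E4) : E4 →L[ℝ] E4)) → ∀ (k : ℕ) (u : ℝ),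
      ‖iteratedDeriv k (fun t ↦ (((Λ t : E4 ≃L[ℝ] E4).symm : E4 ≃L[ℝ] E4) : E4 →L[ℝ] E4)) u‖ ≤
        Cθ * ‖iteratedDeriv k (fun t ↦ ((Λ t : E4 ≃L[ℝ] E4) : E4 →L[ℝ] E4)) u‖ := by
  set Φ : Fin 4 → (E4 →L[ℝ] E4) →L[ℝ] (E4 →L[ℝ] E4) := fun μ ↦
    (((ContinuousLinearMap.smulRightL ℝ E4 E4).flip (E4.basisVector μ)).comp
      (Minkowski.bilin : E4 →L[ℝ] E4 →L[ℝ] ℝ).flip).comp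
      (ContinuousLinearMap.apply ℝ E4 (E4.basisVector μ)) with hΦ
  set Ψ : (E4 →L[ℝ] E4) →L[ℝ] (E4 →L[ℝ] E4) :=
    ∑ μ : Fin 4, (if μ = 0 then (-1 : ℝ) else 1) • Φ μ with hΨ
  refine ⟨‖Ψ‖, norm_nonneg Ψ, fun Λ hΛ k u ↦ ?_⟩
  have hfun : (fun t ↦ (((Λ t : E4 ≃L[ℝ] E4).symm : E4 ≃L[ℝ] E4) : E4 →L[ℝ] E4)) =
      fun t ↦ Ψ ((Λ t : E4 ≃L[ℝ] E4) : E4 →L[ℝ] E4) := by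
    funext t
    rw [lorentz_symm_eq_sum, hΨ, _root_.sum_apply]
    refine Finset.sum_congr rfl fun μ _ ↦ ?_
    rw [FunLike.coe_smul, Pi.smul_apply]
    rfl
  rw [hfun, ← norm_iteratedFDeriv_eq_norm_iteratedDeriv, ← norm_iteratedFDeriv_eq_norm_iteratedDeriv]
  exact Ψ.norm_iteratedFDeriv_comp_left (hΛ.contDiffAt) (by exact_mod_cast le_top)

/-- The inverse boost path is smooth (`contDiff_lorentz_symm`, restated with `∞`). [folklore] -/
theorem contDiff_theta {Λ : ℝ → lorentzGroup} (hΛ : ContDiff ℝ ∞ (fun t ↦ ((Λ t : E4 ≃L[ℝ] E4) : E4 →L[ℝ] E4))) :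
    ContDiff ℝ ∞ (fun t ↦ (((Λ t : E4 ≃L[ℝ] E4).symm : E4 ≃L[ℝ] E4) : E4 →L[ℝ] E4)) :=
  contDiff_lorentz_symm hΛ

/-- `‖Λ(u)⁻¹‖ ≤ 1 + 3γ` when the Lorentz factor of `Λ(u)` is at most `γ` (`norm_lorentz_symm_le`).
[folklore] -/
theorem norm_theta_le {Λ : lorentzGroup} {γ : ℝ} (h1 : 1 ≤ ((Λ : E4 ≃L[ℝ] E4) (E4.basisVector 0)) 0)
    (hγ : ((Λ : E4 ≃L[ℝ] E4) (E4.basisVector 0)) 0 ≤ γ) :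
    ‖(((Λ : E4 ≃L[ℝ] E4).symm : E4 ≃L[ℝ] E4) : E4 →L[ℝ] E4)‖ ≤ 1 + 3 * γ := by
  have h := norm_lorentz_symm_le' Λ
  rw [abs_of_pos (by linarith)] at h
  linarith

/-- `‖Λ(u)‖ ≤ 1 + 3γ` likewise (`norm_lorentz_le`). [folklore] -/
theorem norm_lorentz_le_of_factor {Λ : lorentzGroup} {γ : ℝ} (h1 : 1 ≤ ((Λ : E4 ≃L[ℝ] E4) (E4.basisVector 0)) 0)
    (hγ : ((Λ : E4 ≃L[ℝ] E4) (E4.basisVector 0)) 0 ≤ γ) :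
    ‖((Λ : E4 ≃L[ℝ] E4) : E4 →L[ℝ] E4)‖ ≤ 1 + 3 * γ := by
  have h := norm_lorentz_le Λ
  rw [abs_of_pos (by linarith)] at h
  linarith

/-! ### Alignment in the rest frame -/

/-- **Alignment read in the rest frame**: if `Λe₀ = γ_u (1, ξ′)` with `γ_u ≠ 0` then
`Λ⁻¹(1, ξ′) = γ_u⁻¹ e₀`. [folklore] -/
theorem theta_apply_velocity {Λ : lorentzGroup} {V : E3} {g : ℝ} (hg : g ≠ 0)
    (hal : (Λ : E4 ≃L[ℝ] E4) (E4.basisVector 0) = g • E4.ofTimeSpace 1 V) :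
    (Λ : E4 ≃L[ℝ] E4).symm (E4.ofTimeSpace 1 V) = g⁻¹ • E4.basisVector 0 := by
  have h : E4.ofTimeSpace 1 V = g⁻¹ • (Λ : E4 ≃L[ℝ] E4) (E4.basisVector 0) := by
    rw [hal, smul_smul, inv_mul_cancel₀ hg, one_smul]
  rw [h, map_smul, ContinuousLinearEquiv.symm_apply_apply]

/-- Hence the spatial part of `Λ⁻¹(1, ξ′)` vanishes: the centre's velocity is invisible in the rest
frame. [folklore] -/
theorem spatial_theta_apply_velocity {Λ : lorentzGroup} {V : E3} {g : ℝ} (hg : g ≠ 0)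
    (hal : (Λ : E4 ≃L[ℝ] E4) (E4.basisVector 0) = g • E4.ofTimeSpace 1 V) :
    E4.spatial ((Λ : E4 ≃L[ℝ] E4).symm (E4.ofTimeSpace 1 V)) = 0 := by
  rw [theta_apply_velocity hg hal, map_smul]
  have h0 : E4.spatial (E4.basisVector 0) = 0 := by
    ext i
    simp [E4.spatial_apply, Fin.succ_ne_zero]
  rw [h0, smul_zero]

/-! ### The centre event and the rest-frame offset of the centre -/

/-- The centre event `c(u) = (u, ξ(u)) = u e₀ + (0, ξ(u))` is smooth. [folklore] -/
theorem contDiff_centre {ξ : ℝ → E3} (hξ : ContDiff ℝ ∞ ξ) :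
    ContDiff ℝ ∞ (fun u ↦ E4.ofTimeSpace u (ξ u)) := by
  have e : (fun u ↦ E4.ofTimeSpace u (ξ u)) = fun u : ℝ ↦ u • E4.basisVector 0 + E4.spaceEmbed (ξ u) :=
    funext fun u ↦ E4.ofTimeSpace_eq_smul_add' _ _
  rw [e]
  exact (contDiff_id.smul contDiff_const).add (E4.spaceEmbed.contDiff.comp hξ)

/-- `c′(u) = (1, ξ′(u))`. [folklore] -/
theorem hasDerivAt_centre {ξ : ℝ → E3} (hξ : ContDiff ℝ ∞ ξ) (u : ℝ) :
    HasDerivAt (fun u ↦ E4.ofTimeSpace u (ξ u)) (E4.ofTimeSpace 1 (deriv ξ u)) u := by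
  have e : (fun u ↦ E4.ofTimeSpace u (ξ u)) = fun u : ℝ ↦ u • E4.basisVector 0 + E4.spaceEmbed (ξ u) :=
    funext fun u ↦ E4.ofTimeSpace_eq_smul_add' _ _
  rw [e, E4.ofTimeSpace_eq_smul_add' 1 (deriv ξ u)]
  have h1 : HasDerivAt (fun u : ℝ ↦ u • E4.basisVector 0) ((1 : ℝ) • E4.basisVector 0) u :=
    (hasDerivAt_id u).smul_const _
  have h2 : HasDerivAt (fun u ↦ E4.spaceEmbed (ξ u)) (E4.spaceEmbed (deriv ξ u)) u :=
    E4.spaceEmbed.hasFDerivAt.comp_hasDerivAt u ((hξ.differentiable (by simp)) u).hasDerivAt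
  exact h1.add h2

/-- `‖c(u)‖ ≤ |u| + ‖ξ(u)‖`. [folklore] -/
theorem norm_centre_le (ξ : ℝ → E3) (u : ℝ) : ‖E4.ofTimeSpace u (ξ u)‖ ≤ |u| + ‖ξ u‖ := by
  rw [E4.ofTimeSpace_eq_smul_add']
  refine (norm_add_le _ _).trans (add_le_add ?_ ?_)
  · rw [norm_smul, Real.norm_eq_abs, show ‖E4.basisVector 0‖ = 1 by simp, mul_one]
  · rw [E4.spaceEmbed_apply, norm_eq_spatialNorm_of_apply_zero_eq_zero (E4.ofTimeSpace_apply_zero 0 _),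
      E4.spatialNorm_ofTimeSpace]

/-- **The rest-frame offset of the centre moves only through the frame**: with alignment,
`(S Λ(u)⁻¹ c(u))′ = S (Λ⁻¹)′(u) c(u)` (the term `S Λ⁻¹ c′ = S γ_u⁻¹ e₀` vanishes). [folklore] -/
theorem hasDerivAt_restOffset {Λ : ℝ → lorentzGroup} {ξ : ℝ → E3}
    (hΛ : ContDiff ℝ ∞ (fun t ↦ ((Λ t : E4 ≃L[ℝ] E4) : E4 →L[ℝ] E4))) (hξ : ContDiff ℝ ∞ ξ)
    (hal : ∀ u, (Λ u : E4 ≃L[ℝ] E4) (E4.basisVector 0) =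
      ((Λ u : E4 ≃L[ℝ] E4) (E4.basisVector 0)) 0 • E4.ofTimeSpace 1 (deriv ξ u) ∧
      1 ≤ ((Λ u : E4 ≃L[ℝ] E4) (E4.basisVector 0)) 0) (u : ℝ) :
    HasDerivAt (fun u ↦ E4.spatial ((Λ u : E4 ≃L[ℝ] E4).symm (E4.ofTimeSpace u (ξ u))))
      (E4.spatial (deriv (fun t ↦ (((Λ t : E4 ≃L[ℝ] E4).symm : E4 ≃L[ℝ] E4) : E4 →L[ℝ] E4)) u
        (E4.ofTimeSpace u (ξ u)))) u := by
  have hθ : HasDerivAt (fun t ↦ (((Λ t : E4 ≃L[ℝ] E4).symm : E4 ≃L[ℝ] E4) : E4 →L[ℝ] E4))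
      (deriv (fun t ↦ (((Λ t : E4 ≃L[ℝ] E4).symm : E4 ≃L[ℝ] E4) : E4 →L[ℝ] E4)) u) u :=
    (((contDiff_theta hΛ).differentiable (by simp)) u).hasDerivAt
  have hc := hasDerivAt_centre hξ u
  have h := (hθ.clm_apply hc)
  have hzero : E4.spatial ((((Λ u : E4 ≃L[ℝ] E4).symm : E4 ≃L[ℝ] E4) : E4 →L[ℝ] E4)
      (E4.ofTimeSpace 1 (deriv ξ u))) = 0 := by
    rw [ContinuousLinearEquiv.coe_coe]
    exact spatial_theta_apply_velocity (by linarith [(hal u).2]) (hal u).1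
  have h2 := E4.spatial.hasFDerivAt.comp_hasDerivAt u h
  rw [map_add, hzero, add_zero] at h2
  exact h2

/-! ### Pointwise `Cᵏ` sizes of the moduli paths -/

section Sizes

variable {Λ : ℝ → lorentzGroup} {ξ : ℝ → E3} {A γ τ₀ : ℝ}

/-- **Size of the inverse boost path, global**: with `‖Λ⁽ᵏ⁾(u)‖ ≤ A` (`k ≤ 4`), the derivatives of
orders `1 … 4` of `u ↦ Λ(u)⁻¹` at `u` are `≤ C_θ A`. [folklore] -/
theorem ck₁_theta_global {Cθ : ℝ}
    (hCθ : ∀ (k : ℕ) (u : ℝ),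
      ‖iteratedDeriv k (fun t ↦ (((Λ t : E4 ≃L[ℝ] E4).symm : E4 ≃L[ℝ] E4) : E4 →L[ℝ] E4)) u‖ ≤
        Cθ * ‖iteratedDeriv k (fun t ↦ ((Λ t : E4 ≃L[ℝ] E4) : E4 →L[ℝ] E4)) u‖)
    (hΛ : ContDiff ℝ ∞ (fun t ↦ ((Λ t : E4 ≃L[ℝ] E4) : E4 →L[ℝ] E4))) (hC0 : 0 ≤ Cθ)
    (hA : ∀ u, ∀ k ≤ 4, ‖iteratedDeriv k (fun t ↦ ((Λ t : E4 ≃L[ℝ] E4) : E4 →L[ℝ] E4)) u‖ ≤ A)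
    (u : ℝ) :
    ContDiffAt ℝ 4 (fun t ↦ (((Λ t : E4 ≃L[ℝ] E4).symm : E4 ≃L[ℝ] E4) : E4 →L[ℝ] E4)) u ∧
      ∀ i, 1 ≤ i → i ≤ 4 →
        ‖iteratedFDeriv ℝ i (fun t ↦ (((Λ t : E4 ≃L[ℝ] E4).symm : E4 ≃L[ℝ] E4) : E4 →L[ℝ] E4)) u‖ ≤
          Cθ * A :=
  ck₁_of_iteratedDeriv ((contDiff_theta hΛ).of_le (WithTop.coe_le_coe.mpr le_top)).contDiffAt
    fun i _ hi ↦ (hCθ i u).trans (mul_le_mul_of_nonneg_left (hA u i hi) hC0)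

/-- **Size of the inverse boost path, tame**: with `u² ‖Λ⁽ᵏ⁾(u)‖ ≤ A` (`1 ≤ k ≤ 4`, `u ≥ τ₀ > 0`),
the derivatives of orders `1 … 4` of `u ↦ Λ(u)⁻¹` at `u ≥ τ₀` are `≤ C_θ A / u²`. [folklore] -/
theorem ck₁_theta_tame {Cθ : ℝ}
    (hCθ : ∀ (k : ℕ) (u : ℝ),
      ‖iteratedDeriv k (fun t ↦ (((Λ t : E4 ≃L[ℝ] E4).symm : E4 ≃L[ℝ] E4) : E4 →L[ℝ] E4)) u‖ ≤
        Cθ * ‖iteratedDeriv k (fun t ↦ ((Λ t : E4 ≃L[ℝ] E4) : E4 →L[ℝ] E4)) u‖)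
    (hΛ : ContDiff ℝ ∞ (fun t ↦ ((Λ t : E4 ≃L[ℝ] E4) : E4 →L[ℝ] E4))) (hC0 : 0 ≤ Cθ) (hτ₀ : 0 < τ₀)
    (htame : ∀ u, τ₀ ≤ u → ∀ k, 1 ≤ k → k ≤ 4 →
      u ^ 2 * ‖iteratedDeriv k (fun t ↦ ((Λ t : E4 ≃L[ℝ] E4) : E4 →L[ℝ] E4)) u‖ ≤ A)
    {u : ℝ} (hu : τ₀ ≤ u) :
    ContDiffAt ℝ 4 (fun t ↦ (((Λ t : E4 ≃L[ℝ] E4).symm : E4 ≃L[ℝ] E4) : E4 →L[ℝ] E4)) u ∧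
      ∀ i, 1 ≤ i → i ≤ 4 →
        ‖iteratedFDeriv ℝ i (fun t ↦ (((Λ t : E4 ≃L[ℝ] E4).symm : E4 ≃L[ℝ] E4) : E4 →L[ℝ] E4)) u‖ ≤
          Cθ * A / u ^ 2 := by
  have hu0 : 0 < u := hτ₀.trans_le hu
  refine ck₁_of_iteratedDeriv ((contDiff_theta hΛ).of_le (WithTop.coe_le_coe.mpr le_top)).contDiffAt
    fun i hi1 hi ↦ (hCθ i u).trans ?_
  rw [mul_div_assoc]
  refine mul_le_mul_of_nonneg_left ?_ hC0
  rw [le_div_iff₀ (by positivity), mul_comm]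
  exact htame u hu i hi1 hi

/-- **Size of the centre event path**: `‖c(u)‖ ≤ |u| + ‖ξ(u)‖` and `‖c⁽ᵏ⁾(u)‖ ≤ 1 + A` (`1 ≤ k ≤ 3`).
[folklore] -/
theorem ck_centre (hξ : ContDiff ℝ ∞ ξ) (hA : ∀ u, ∀ k, 1 ≤ k → k ≤ 5 → ‖iteratedDeriv k ξ u‖ ≤ A)
    (u : ℝ) :
    ContDiffAt ℝ 3 (fun u ↦ E4.ofTimeSpace u (ξ u)) u ∧
      ∀ i ≤ 3, ‖iteratedFDeriv ℝ i (fun u ↦ E4.ofTimeSpace u (ξ u)) u‖ ≤ |u| + ‖ξ u‖ + 1 + A := by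
  have hA0 : 0 ≤ A := (norm_nonneg _).trans (hA u 1 le_rfl (by norm_num))
  have h := ck₁_of_iteratedDeriv (n := 3) (C := 1 + A)
    ((contDiff_centre hξ).of_le (WithTop.coe_le_coe.mpr le_top)).contDiffAt
    (fun i hi1 hi ↦ (norm_iteratedDeriv_centre_le hξ u hi1 (WithTop.coe_le_coe.mpr le_top)).trans
      (by linarith [hA u i hi1 (by omega)]))
  refine ck_mono (ck_of_ck₁ h (norm_centre_le ξ u)) le_rfl ?_
  exact max_le (by linarith) (by linarith [abs_nonneg u, norm_nonneg (ξ u)])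

/-- **Size of the rest-frame offset of the centre.** With alignment, `b(u) = S Λ(u)⁻¹ c(u)` satisfies
`‖b(u)‖ ≤ (1 + 3γ)(|u| + ‖ξ(u)‖)` and, if the derivatives of orders `1 … 4` of `Λ⁻¹` at `u` are
`≤ η`, `‖b⁽ᵏ⁾(u)‖ ≤ 4 η (|u| + ‖ξ(u)‖ + 1 + A)` for `1 ≤ k ≤ 3` (from `b′ = S (Λ⁻¹)′ c` and Leibniz).
[folklore] -/
theorem ck₁_restOffset (hΛ : ContDiff ℝ ∞ (fun t ↦ ((Λ t : E4 ≃L[ℝ] E4) : E4 →L[ℝ] E4)))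
    (hξ : ContDiff ℝ ∞ ξ) (hA : ∀ u, ∀ k, 1 ≤ k → k ≤ 5 → ‖iteratedDeriv k ξ u‖ ≤ A)
    (hal : ∀ u, (Λ u : E4 ≃L[ℝ] E4) (E4.basisVector 0) =
      ((Λ u : E4 ≃L[ℝ] E4) (E4.basisVector 0)) 0 • E4.ofTimeSpace 1 (deriv ξ u) ∧
      1 ≤ ((Λ u : E4 ≃L[ℝ] E4) (E4.basisVector 0)) 0) {u η : ℝ}
    (hθ : ContDiffAt ℝ 4 (fun t ↦ (((Λ t : E4 ≃L[ℝ] E4).symm : E4 ≃L[ℝ] E4) : E4 →L[ℝ] E4)) u ∧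
      ∀ i, 1 ≤ i → i ≤ 4 →
        ‖iteratedFDeriv ℝ i (fun t ↦ (((Λ t : E4 ≃L[ℝ] E4).symm : E4 ≃L[ℝ] E4) : E4 →L[ℝ] E4)) u‖ ≤ η) :
    ContDiffAt ℝ 3 (fun u ↦ E4.spatial ((Λ u : E4 ≃L[ℝ] E4).symm (E4.ofTimeSpace u (ξ u)))) u ∧
      ∀ i, 1 ≤ i → i ≤ 3 →
        ‖iteratedFDeriv ℝ i (fun u ↦ E4.spatial ((Λ u : E4 ≃L[ℝ] E4).symm (E4.ofTimeSpace u (ξ u)))) u‖ ≤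
          4 * η * (|u| + ‖ξ u‖ + 1 + A) := by
  -- `b′ = S (θ′ c)` as functions
  have hderiv : deriv (fun u ↦ E4.spatial ((Λ u : E4 ≃L[ℝ] E4).symm (E4.ofTimeSpace u (ξ u)))) =
      fun u ↦ E4.spatial (deriv (fun t ↦ (((Λ t : E4 ≃L[ℝ] E4).symm : E4 ≃L[ℝ] E4) : E4 →L[ℝ] E4)) u
        (E4.ofTimeSpace u (ξ u))) :=
    funext fun u ↦ (hasDerivAt_restOffset hΛ hξ hal u).deriv
  have hsmooth : ContDiff ℝ ∞ (fun u ↦ E4.spatial ((Λ u : E4 ≃L[ℝ] E4).symm (E4.ofTimeSpace u (ξ u)))) := by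
    have h1 : ContDiff ℝ ∞ (fun u ↦ (((Λ u : E4 ≃L[ℝ] E4).symm : E4 ≃L[ℝ] E4) : E4 →L[ℝ] E4)
        (E4.ofTimeSpace u (ξ u))) := (contDiff_theta hΛ).clm_apply (contDiff_centre hξ)
    exact E4.spatial.contDiff.comp h1
  refine ⟨(hsmooth.of_le (WithTop.coe_le_coe.mpr le_top)).contDiffAt, fun i hi1 hi ↦ ?_⟩
  obtain ⟨k, rfl⟩ := Nat.exists_eq_add_of_le' hi1
  rw [norm_iteratedFDeriv_eq_norm_iteratedDeriv, iteratedDeriv_succ', hderiv,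
    ← norm_iteratedFDeriv_eq_norm_iteratedDeriv]
  -- sizes of `θ′` and `c` at `u`, order `k ≤ 2`
  have hθ' : ContDiffAt ℝ k (deriv (fun t ↦ (((Λ t : E4 ≃L[ℝ] E4).symm : E4 ≃L[ℝ] E4) : E4 →L[ℝ] E4))) u ∧
      ∀ i ≤ k, ‖iteratedFDeriv ℝ i
        (deriv (fun t ↦ (((Λ t : E4 ≃L[ℝ] E4).symm : E4 ≃L[ℝ] E4) : E4 →L[ℝ] E4))) u‖ ≤ η := by
    refine ⟨hθ.1.derivWithin (by norm_cast; omega), fun i hi ↦ ?_⟩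
    rw [norm_iteratedFDeriv_eq_norm_iteratedDeriv, ← iteratedDeriv_succ',
      ← norm_iteratedFDeriv_eq_norm_iteratedDeriv]
    exact hθ.2 (i + 1) (by omega) (by omega)
  have hc := ck_mono (ck_centre hξ hA u) (show k ≤ 3 by omega) le_rfl
  have h := ck_clm_comp_left (ck_clm_apply hθ' hc) (E4.spatial : E4 →L[ℝ] E3)
  refine (h.2 k le_rfl).trans ?_
  have hη : 0 ≤ η := ck_nonneg hθ'
  have hc0 : 0 ≤ |u| + ‖ξ u‖ + 1 + A := ck_nonneg hc
  have h2 : (2 : ℝ) ^ k ≤ 4 := by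
    have : k ≤ 2 := by omega
    interval_cases k <;> norm_num
  have hS : ‖(E4.spatial : E4 →L[ℝ] E3)‖ ≤ 1 := by
    refine ContinuousLinearMap.opNorm_le_bound _ zero_le_one fun x ↦ ?_
    rw [one_mul]
    have hx : ‖x‖ ^ 2 = x 0 ^ 2 + ‖E4.spatial x‖ ^ 2 := by
      rw [← E4.spatialNorm]; exact norm_sq_eq_sq_add_spatialNorm_sq x
    nlinarith [norm_nonneg x, norm_nonneg (E4.spatial x), sq_nonneg (x 0)]
  calc ‖(E4.spatial : E4 →L[ℝ] E3)‖ * (2 ^ k * η * (|u| + ‖ξ u‖ + 1 + A))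
      ≤ 1 * (4 * η * (|u| + ‖ξ u‖ + 1 + A)) := by
        refine mul_le_mul hS ?_ (by positivity) zero_le_one
        exact mul_le_mul_of_nonneg_right (mul_le_mul_of_nonneg_right h2 hη) hc0
    _ = 4 * η * (|u| + ‖ξ u‖ + 1 + A) := one_mul _

/-- Order zero of the rest-frame offset: `‖S Λ(u)⁻¹ c(u)‖ ≤ (1 + 3γ)(|u| + ‖ξ(u)‖)`. [folklore] -/
theorem norm_restOffset_le {u : ℝ} (h1 : 1 ≤ ((Λ u : E4 ≃L[ℝ] E4) (E4.basisVector 0)) 0)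
    (hγ : ((Λ u : E4 ≃L[ℝ] E4) (E4.basisVector 0)) 0 ≤ γ) :
    ‖E4.spatial ((Λ u : E4 ≃L[ℝ] E4).symm (E4.ofTimeSpace u (ξ u)))‖ ≤ (1 + 3 * γ) * (|u| + ‖ξ u‖) := by
  have hS : ‖E4.spatial ((Λ u : E4 ≃L[ℝ] E4).symm (E4.ofTimeSpace u (ξ u)))‖ ≤
      ‖(Λ u : E4 ≃L[ℝ] E4).symm (E4.ofTimeSpace u (ξ u))‖ := by
    have hx := norm_sq_eq_sq_add_spatialNorm_sq ((Λ u : E4 ≃L[ℝ] E4).symm (E4.ofTimeSpace u (ξ u)))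
    rw [E4.spatialNorm] at hx
    nlinarith [norm_nonneg ((Λ u : E4 ≃L[ℝ] E4).symm (E4.ofTimeSpace u (ξ u))),
      norm_nonneg (E4.spatial ((Λ u : E4 ≃L[ℝ] E4).symm (E4.ofTimeSpace u (ξ u)))),
      sq_nonneg (((Λ u : E4 ≃L[ℝ] E4).symm (E4.ofTimeSpace u (ξ u))) 0)]
  refine hS.trans ?_
  have h := ((((Λ u : E4 ≃L[ℝ] E4).symm : E4 ≃L[ℝ] E4) : E4 →L[ℝ] E4)).le_opNorm (E4.ofTimeSpace u (ξ u))
  rw [ContinuousLinearEquiv.coe_coe] at h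
  exact h.trans (mul_le_mul (norm_theta_le h1 hγ) (norm_centre_le ξ u) (norm_nonneg _) (by linarith))

/-- The rest-frame offset of the centre `b(u) = S Λ(u)⁻¹ c(u)` is smooth. [folklore] -/
theorem contDiff_restOffset (hΛ : ContDiff ℝ ∞ (fun t ↦ ((Λ t : E4 ≃L[ℝ] E4) : E4 →L[ℝ] E4)))
    (hξ : ContDiff ℝ ∞ ξ) :
    ContDiff ℝ ∞ (fun u ↦ E4.spatial ((Λ u : E4 ≃L[ℝ] E4).symm (E4.ofTimeSpace u (ξ u)))) := by
  have h1 : ContDiff ℝ ∞ (fun u ↦ (((Λ u : E4 ≃L[ℝ] E4).symm : E4 ≃L[ℝ] E4) : E4 →L[ℝ] E4)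
      (E4.ofTimeSpace u (ξ u))) := (contDiff_theta hΛ).clm_apply (contDiff_centre hξ)
  exact E4.spatial.contDiff.comp h1

/-- **Tame frame on the clock interval**: for `τ₀ ≤ U ≤ s`, the derivatives of orders `1 … 4` of
`u ↦ Λ(u)⁻¹` at `s` are `≤ C_θ A / U²`. [folklore] -/
theorem tame_theta_Icc (hsm : ContDiff ℝ ∞ (fun t ↦ ((Λ t : E4 ≃L[ℝ] E4) : E4 →L[ℝ] E4))) {Cθ : ℝ}
    (hCθ0 : 0 ≤ Cθ)
    (hCθ : ∀ (k : ℕ) (u : ℝ),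
      ‖iteratedDeriv k (fun t ↦ (((Λ t : E4 ≃L[ℝ] E4).symm : E4 ≃L[ℝ] E4) : E4 →L[ℝ] E4)) u‖ ≤
        Cθ * ‖iteratedDeriv k (fun t ↦ ((Λ t : E4 ≃L[ℝ] E4) : E4 →L[ℝ] E4)) u‖)
    (hτ₀ : 0 < τ₀) (hA : 0 ≤ A)
    (htame : ∀ u, τ₀ ≤ u → ∀ k, 1 ≤ k → k ≤ 4 →
      u ^ 2 * ‖iteratedDeriv k (fun t ↦ ((Λ t : E4 ≃L[ℝ] E4) : E4 →L[ℝ] E4)) u‖ ≤ A)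
    {U s : ℝ} (hU : τ₀ ≤ U) (hs : U ≤ s) :
    ContDiffAt ℝ 4 (fun t ↦ (((Λ t : E4 ≃L[ℝ] E4).symm : E4 ≃L[ℝ] E4) : E4 →L[ℝ] E4)) s ∧
      ∀ i, 1 ≤ i → i ≤ 4 →
        ‖iteratedFDeriv ℝ i (fun t ↦ (((Λ t : E4 ≃L[ℝ] E4).symm : E4 ≃L[ℝ] E4) : E4 →L[ℝ] E4)) s‖ ≤
          Cθ * A / U ^ 2 := by
  have hU0 : 0 < U := hτ₀.trans_le hU
  have h := ck₁_theta_tame hCθ hsm hCθ0 hτ₀ htame (hU.trans hs)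
  refine ck₁_mono h le_rfl ?_
  exact div_le_div_of_nonneg_left (mul_nonneg hCθ0 hA) (by positivity)
    (pow_le_pow_left₀ hU0.le hs 2)

end Sizes

end OneHole

/-- Registered sub-goal form (stub `oneHole_lorentz_symm_apply_eq_sum` of the crux item) of
`OneHole.lorentz_symm_apply_eq_sum`: `Λ⁻¹ w = Σ_μ η_μμ η(w, Λe_μ) e_μ` on `O(1,3)` (O'Neill 1983, Ch. 9,
p. 234). [folklore] -/
theorem oneHole_lorentz_symm_apply_eq_sum : open Literature.Geometry.Lorentzian in ∀ (Λ : lorentzGroup) (w : E4), (Λ : E4 ≃L[ℝ] E4).symm w = ∑ μ : Fin 4, (if μ = 0 then (-1 : ℝ) else 1) • (Minkowski.bilin w ((Λ : E4 ≃L[ℝ] E4) (E4.basisVector μ)) • E4.basisVector μ) :=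
  fun Λ w ↦ OneHole.lorentz_symm_apply_eq_sum Λ w

end Summit.FinalStateConjecture.FinalStateConjecture.Theorems

end
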